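import Literature.Computability.AlgebraicComplexity.MS21SigmaPiSigmaClosureProofs
import Literature.Computability.AlgebraicComplexity.MS21FormulasToANF
import Literature.Computability.AlgebraicComplexity.MS21ReadOnceOrbitsProofs
import HarnessLib

/-!
# Medini–Shpilka 2021, Thm 32 (closures): `cl ANF^{GLaff}(F) = cl ROF^{GL}(F) = cl VP_e(F)` — proofs

Discharge of the named fact `MS2021_thm_32_closure` of
`Literature/Computability/AlgebraicComplexity/MS21DenseOrbitsHittingSets.lean` (cell `val-lit`,
seat t20): `theorem MS2021_thm_32_closure_holds : MS2021_thm_32_closure` — the orbits of read-once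
formulas, indeed of the canonical ROANFs `ANF_Δ`, are DENSE in `VP_e` (closure of Def 9 through
`F(ε) = RatFunc F`; v2 classes), for EVERY field `F`.

## The printed proof (arXiv:2102.05632 p0026:L17-L19) and its rendering

"[GKQ14, Proposition 3.2]: for every formula `Φ` of size `s` there is an ANF formula of size
`O(s⁴)` computing the same polynomial; its leaf linear forms are then approximated by linearly
independent ones." Typed as `cl VP_e(F) ⊆ cl ANF^{GLaff}(F)`
(`MS2021.closure_vpeClass_subset_closure_anfAffClass`), level by level:

* the `F(ε)`-approximant `g_{m(n)}` of `f_n` has polynomially bounded formula size `s`, hence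
  (`MS2021.exists_anf_affine_of_formulaComplexity`, `MS21FormulasToANF.lean`: Brent's depth
  reduction + padding identities) `g_{m(n)} = ANF_Δ(ℓ_1, …, ℓ_{4^Δ})` with affine `ℓ_i` over `F(ε)`
  and `4^Δ ≤ (s+1)^16`;
* the density step for the template `ANF_Δ` (`MS2021.exists_mem_affOrbit_isEpsApprox_of_aeval`,
  `MS21SigmaPiSigmaClosureProofs.lean`): `ANF_Δ(ℓ_i + η·y_i)` lies in `ANF_Δ^{GLaff_{M+4^Δ}(F(ε))}`
  and is `f_n + O(ε)` (the printed "approximated by linearly independent ones", with denominators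
  cleared: `η = ε·q^{deg}`);
* family bookkeeping as for Thm 42: padding to a strictly increasing p-bounded level function
  `m'(n) = n + n^c + c ≥ m(n) + 4^Δ`, default member `ANF_0(1·x + 0) ∈ ANF_0^{GLaff_N}` at the
  levels `N ≥ 1` off the image of `m'` (the v2 class constrains levels `N ≥ 1` only).

The `⊆`-chain `cl ANF^{GLaff} ⊆ cl ROF^{GL} ⊆ cl VP_e` is closure monotonicity (`MS2021.closure_mono`)
along `MS2021_thm_32_incl_holds` taken over `F(ε)`. Theorem-only file: no definition, no named fact
(D-0026); no `instance`, no `notation`. `VP ≠ VNP` is NOT proved and nothing here bears on it beyond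
discharging a typed literature statement by name (LADDER-VALIANT V4, ideation).

## References
* [MediniShpilka2021] D. Medini, A. Shpilka, CCC 2021, LIPIcs 200:19, Thm 32 eq. (6) (p.19:12) =
  arXiv:2102.05632 ‹theoremROANFisDense› (p0008:L12-L16); proof p0026:L17-L19; Def 8–9 (p.19:7).
* A. Gupta, N. Kayal, Y. Qiao, Comput. Complexity 23 (2014), Prop. 3.2 (as cited there).
-/

noncomputable section

open MvPolynomial

namespace Literature.Computability.AlgebraicComplexity

namespace MS2021

section Helpers

variable {K : Type*} [Field K]

/-- `ANF_Δ` has integer coefficients: it is preserved by every change of scalars. [cite: MediniShpilka2021, Def 8 (CCC p.19:7)] -/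
theorem map_anf {R S : Type*} [CommSemiring R] [CommSemiring S] (φ : R →+* S) :
    ∀ Δ : ℕ, map φ (anf R Δ) = anf S Δ
  | 0 => by simp [anf]
  | Δ + 1 => by simp only [anf, map_add, map_mul, map_rename, map_anf φ Δ]

/-- Padding the variables of an affine-leaf evaluation `T(ℓ_1(x), …, ℓ_E(x))` keeps it of that form
(the new variables get coefficient `0`). [cite: MediniShpilka2021, Def 7 and Def 9 (CCC p.19:7)] -/
private theorem exists_rename_castLE_aeval_affine {M M' E : ℕ} (h : M ≤ M')
    (β : Fin E → Option (Fin M) → RatFunc K) (T : MvPolynomial (Fin E) (RatFunc K)) :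
    ∃ β' : Fin E → Option (Fin M') → RatFunc K,
      rename (Fin.castLE h) (aeval (fun i => C (β i none) + ∑ k : Fin M, C (β i (some k)) * X k) T) =
        aeval (fun i => C (β' i none) + ∑ k : Fin M', C (β' i (some k)) * X k) T := by
  classical
  refine ⟨fun i o => o.elim (β i none) fun k' =>
    ∑ k : Fin M, if Fin.castLE h k = k' then β i (some k) else 0, ?_⟩
  rw [← AlgHom.comp_apply, comp_aeval]
  have hfun : (fun i => rename (Fin.castLE h)
      (C (β i none) + ∑ k : Fin M, C (β i (some k)) * X k : MvPolynomial (Fin M) (RatFunc K))) =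
      fun i => C (β i none) + ∑ k' : Fin M',
        C (∑ k : Fin M, if Fin.castLE h k = k' then β i (some k) else 0) * X k' := by
    funext i
    simp only [map_add, map_sum, map_mul, rename_C, rename_X]
    congr 1
    simp only [Finset.sum_mul]
    rw [Finset.sum_comm]
    refine Finset.sum_congr rfl fun k _ => ?_
    simp only [apply_ite C, C_0, ite_mul, zero_mul, Finset.sum_ite_eq, Finset.mem_univ, if_true]
  exact congrArg (fun φ : Fin E → MvPolynomial (Fin M') (RatFunc K) => aeval φ T) hfun

/-- A family given at the levels `m' n` of an injective `m'` extends to all levels with a prescribed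
default elsewhere. [folklore] -/
private theorem exists_family_extension' {R : Type*} [CommSemiring R] (m' : ℕ → ℕ)
    (hm' : Function.Injective m') (P : ∀ n, MvPolynomial (Fin (m' n)) R)
    (d : ∀ N, MvPolynomial (Fin N) R) :
    ∃ g : ∀ N, MvPolynomial (Fin N) R,
      (∀ n, g (m' n) = P n) ∧ ∀ N, (∀ n, m' n ≠ N) → g N = d N := by
  classical
  have key : ∀ {a b : ℕ} (_ : a = b) (e' : m' a = m' b), rename (Fin.cast e') (P a) = P b := by
    intro a b e e'
    subst e
    have hid : Fin.cast e' = id := funext fun i => Fin.ext rfl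
    rw [hid]
    exact rename_id_apply _
  refine ⟨fun N => if hN : ∃ n, m' n = N then rename (Fin.cast hN.choose_spec) (P hN.choose) else d N,
    fun n => ?_, fun N hN => ?_⟩
  · have hN : ∃ n', m' n' = m' n := ⟨n, rfl⟩
    dsimp only
    rw [dif_pos hN]
    exact key (hm' hN.choose_spec) hN.choose_spec
  · dsimp only
    rw [dif_neg (not_exists.mpr hN)]

end Helpers

end MS2021

/-! ### The discharge -/

section Discharge

open MS2021

/-- **`cl VP_e(K) ⊆ cl ANF^{GLaff}(K)` for every field `K`** (density of ROANF orbits in `VP_e`):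
level by level `ANF_Δ(Ax+b) = g_{m(n)} + O(ε) = f_n + O(ε)` with `4^Δ ≤ (E(g_{m(n)})+1)^16`
(`exists_anf_affine_of_formulaComplexity` + `exists_mem_affOrbit_isEpsApprox_of_aeval`), after
padding to a strictly increasing p-bounded level `m'(n) ≥ m(n) + 4^Δ`; off the image of `m'` the
witness family is `ANF_0(1·x + 0) ∈ ANF_0^{GLaff_N}` (`N ≥ 1`).
[cite: MediniShpilka2021, Thm 32 eq. (6) (CCC p.19:12; arXiv ‹theoremROANFisDense› p0008:L12-L16; proof p0026:L17-L19)] -/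
theorem MS2021.closure_vpeClass_subset_closure_anfAffClass (K : Type) [Field K] :
    closure (VPeClass (RatFunc K)) ⊆ closure (ANFAffClass (RatFunc K)) := by
  classical
  rintro f ⟨m, hm, g, hg, hfg⟩
  have hg' : IsPBounded fun N => formulaComplexity (g N) := hg
  -- per level: `g (m n) = ANF_Δ(affine leaves)` with `4^Δ ≤ (E + 1)^16`
  have key0 : ∀ n, ∃ (Δ : ℕ) (β : Fin (4 ^ Δ) → Option (Fin (m n)) → RatFunc K),
      4 ^ Δ ≤ (formulaComplexity (g (m n)) + 1) ^ 16 ∧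
        g (m n) = aeval (fun i => C (β i none) + ∑ k : Fin (m n), C (β i (some k)) * X k)
          (anf (RatFunc K) Δ) :=
    fun n => exists_anf_affine_of_formulaComplexity (g (m n))
  choose Δ β hΔ hgβ using key0
  -- a strictly increasing p-bounded level function dominating `m(n) + 4^Δ`
  obtain ⟨c, hc⟩ : IsPBounded fun n => m n + (formulaComplexity (g (m n)) + 1) ^ 16 :=
    IsPBounded.add_holds hm (IsPBounded.pow_holds
      (IsPBounded.add_holds (IsPBounded.comp_holds hg' hm) (IsPBounded.const 1)) 16)
  let m' : ℕ → ℕ := fun n => n + (n ^ c + c)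
  have hm'mono : StrictMono m' := fun a b hab => by
    show a + (a ^ c + c) < b + (b ^ c + c)
    have := Nat.pow_le_pow_left hab.le c
    omega
  have hm'pb : IsPBounded m' := IsPBounded.add_holds IsPBounded.id ⟨c, fun n => le_rfl⟩
  have hle : ∀ n, m n + 4 ^ Δ n ≤ m' n := fun n =>
    ((Nat.add_le_add_left (hΔ n) _).trans (hc n)).trans (Nat.le_add_left _ _)
  -- per level: a member of the `ANF_Δ`-orbit at level `m' n` approximating `f n`
  have key : ∀ n, ∃ G' ∈ affOrbit (m' n) (anf (RatFunc K) (Δ n)), IsEpsApprox (f n) G' := by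
    intro n
    obtain ⟨t, ht⟩ := Nat.exists_eq_add_of_le (hle n)
    obtain ⟨β', hβ'⟩ := exists_rename_castLE_aeval_affine (Nat.le_add_right (m n) t) (β n)
      (anf (RatFunc K) (Δ n))
    have happ : IsEpsApprox (f n)
        (aeval (fun i => C (β' i none) + ∑ k : Fin (m n + t), C (β' i (some k)) * X k)
          (map (algebraMap K (RatFunc K)) (anf K (Δ n)))) := by
      rw [map_anf, ← hβ', ← hgβ]
      exact (hfg n).rename_castLE _
    have h3 := exists_mem_affOrbit_isEpsApprox_of_aeval (f n) (anf K (Δ n)) β' happ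
    rw [map_anf] at h3
    rw [ht, Nat.add_right_comm]
    exact h3
  choose G' hG'mem hG'app using key
  obtain ⟨g', hg'₁, hg'₂⟩ := exists_family_extension' m' hm'mono.injective G'
    (fun N => if hN : 1 ≤ N then affSubst hN 1 0 (anf (RatFunc K) 0) else 0)
  refine ⟨m', hm'pb, g', fun N hN => ?_, fun n => ?_⟩
  · by_cases himg : ∃ n, m' n = N
    · obtain ⟨n, rfl⟩ := himg
      refine ⟨Δ n, le_trans (Nat.le_add_left _ _) (hle n), ?_⟩
      rw [hg'₁]
      exact hG'mem n
    · have hN1 : 1 ≤ N := hN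
      refine ⟨0, by simpa using hN1, ?_⟩
      rw [hg'₂ N (not_exists.mp himg), dif_pos hN1]
      exact ⟨hN1, 1, 0, by simp, rfl⟩
  · rw [hg'₁]
    exact hG'app n

/-- **MS Thm 32 (closures), discharged**: `cl ANF^{GLaff}(F) = cl ROF^{GL}(F) = cl VP_e(F)` for every
field `F` — by closure monotonicity along `ANF^{GLaff} ⊆ ROF^{GL} ⊆ VP_e` over `F(ε)`
(`MS2021_thm_32_incl_holds`) and `cl VP_e ⊆ cl ANF^{GLaff}`.
[cite: MediniShpilka2021, Thm 32 eq. (6) (CCC 2021 LIPIcs 200:19, p.19:12; = arXiv:2102.05632 ‹theoremROANFisDense›, p0008:L12-L16; proof p0026:L17-L19)] -/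
theorem MS2021_thm_32_closure_holds : MS2021_thm_32_closure := by
  intro K _
  have h1 := MS2021.closure_mono (MS2021.anfAffClass_subset_rofLinClass (RatFunc K))
  have h2 := MS2021.closure_mono (MS2021.rofLinClass_subset_vpeClass (RatFunc K))
  have h3 := MS2021.closure_vpeClass_subset_closure_anfAffClass K
  exact ⟨h1.antisymm (h2.trans h3), h2.antisymm (h3.trans h1)⟩

end Discharge

end Literature.Computability.AlgebraicComplexity

end
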